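/-
Copyright (c) 2026 the pub-hodgecm-mathlib formalisation cell (harness21).  Prover seat hodgecm-mathlib-K2E5-p16 (g4): Track B «K2-LIT»,
hLiu418 = stmt-HodgeConjecture-24832, ROAD Φ organ Φ6b-2 (self-offered under LEAD F0P6-plan (g12) ∕ co-dealer K2E5-plan (g5)): ABSOLUTE
CONVERGENCE of Shimura's `η(g, h; α, β)` on `Herm₂(ℂ)` for `g, h > 0` — for EVERY `α` and `re β > 1`; 2026-09-04.
-/
import Summits.HodgeConjecture.HodgeConjecture.Theorems.K2LiuHermTwoEtaDefs                   -- ★ (this seat): `etaTwo`, `etaTwoSet`, `etaTwoIntegrand`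
import Summits.HodgeConjecture.HodgeConjecture.Theorems.K2LiuHermTwoGammaSiegelGindikin       -- ★ p857689: `integrableOn_siegelGindikin`
import Mathlib.Analysis.Complex.Exponential
import Mathlib.MeasureTheory.Group.Measure
import HarnessLib

/-!
# Crux `HLiu418`, ROAD Φ, organ Φ6b-2: Shimura's `η(g, h; α, β)` converges absolutely for `g, h > 0`, ALL `α ∈ ℂ` and `re β > 1`

Cell `hodgecm-mathlib`, crux item hLiu418 = `stmt-HodgeConjecture-24832`, route of record `HCCMUnconditional`; squad K2, LEAD F0P6-plan (g12), co-dealer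
K2E5-plan (g5), prover K2E5-p16 (g4).  THEOREMS ONLY (no `def`, no instance, no notation, no named-fact hypothesis, no `sorry`, default heartbeats); lane
`--supports stmt-HodgeConjecture-24832 --as helper` (count-neutral helper).

WHAT IS PROVED [Shimura1982, §1 + §3 Thm 3.1 (the `h > 0` case), Case II, m = κ = 2].  For `g, h` positive definite Hermitian `2 × 2` matrices:
* `integrableOn_etaTwoIntegrand_of_posDef (hg : g.PosDef) (hh : h.PosDef) (α : ℂ) (hβ : 1 < β.re) : IntegrableOn (etaTwoIntegrand g h α β) (etaTwoSet h)`
  — `η(g, h; α, β) = ∫_{x − h > 0} e^{−τ(gx)} det(x+h)^{α−2} det(x−h)^{β−2} dx` converges absolutely for EVERY `α` (the domain forces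
  `x + h > 2h`, so `det(x + h) ≥ det(2h) > 0` carries no singularity) and `re β > 1` (the Siegel–Gindikin abscissa at `det(x − h) = 0`).
TOOLS (all in the chart, print-free): `trace_mul_lower_bound` (`(det g/tr g)·tr x ≤ τ(x g)` for `x, g > 0` — so `τ(xg) ≥ 0` and `tr x` is
controlled by `τ(xg)`), `det_add_ge` (`det(x + k) ≥ det k` for `x, k > 0`), `det_le_trace_sq` (`det u ≤ (tr u)²` on the cone), `rpow_le_const_mul_exp`
(`(T/λ + T₀)^r ≤ K·e^{T/2}`, ★ `Real.pow_div_factorial_le_exp`), whence the KEY DOMINATION `det(x + 2h)^{re α − 2} ≤ K · e^{τ(x g)/2}` on the cone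
and `‖η-integrand(x + h)‖ ≤ K′ · ‖Siegel–Gindikin integrand of (g/2, β)(x)‖`, integrable by ★ `integrableOn_siegelGindikin`; the translation
`x ↦ x + h` is measure preserving (★ `measurePreserving_add_right`).
NOT here: indefinite `h` (needs `re α > 1` too and Shimura §4), holomorphy of `η` in `α` (sequel), the `ξ`–`η` identity (Fourier inversion; sequel).
HONEST LABEL.  Count-neutral helper of the K2_Liu road; it pays no socket by itself: `HC_CM` is proved only modulo the 7 printed citations
(2 remaining named inputs: hLiu418 = `stmt-HodgeConjecture-24832`, h413 = `stmt-HodgeConjecture-24833`) until rung 0 closes.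
-/

set_option autoImplicit false
-- the mandated namespace repeats the single-problem summit's segment (`HodgeConjecture.HodgeConjecture`)
set_option linter.dupNamespace false

noncomputable section

open Complex MeasureTheory Set
open scoped ComplexOrder ComplexConjugate

namespace Summit.HodgeConjecture.HodgeConjecture.Cruxes.HLiu418.K2LiuHermTwoEtaConvergence

open Summit.HodgeConjecture.HodgeConjecture.Cruxes.HLiu418.K2LiuHermTwoGammaDefs
open Summit.HodgeConjecture.HodgeConjecture.Cruxes.HLiu418.K2LiuHermTwoEtaDefs
open Summit.HodgeConjecture.HodgeConjecture.Cruxes.HLiu418.K2LiuHermTwoGammaSiegelGindikin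

/-! ## Inequalities in the chart -/

/-- `re(z w̄) ≥ −‖z‖‖w‖`. -/
theorem re_mul_conj_ge (z w : ℂ) : -(‖z‖ * ‖w‖) ≤ (z * conj w).re := by
  have h := Complex.abs_re_le_norm (z * conj w)
  rw [norm_mul, Complex.norm_conj] at h
  linarith [neg_abs_le (z * conj w).re]

/-- On the cone `‖z‖² < a b` with `0 < a` we have `0 < b`. -/
theorem snd_pos_of_cone {a b : ℝ} {z : ℂ} (ha : 0 < a) (hz : normSq z < a * b) : 0 < b :=
  (mul_pos_iff_of_pos_left ha).mp (lt_of_le_of_lt (normSq_nonneg z) hz)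

/-- TRACE LOWER BOUND: for `x = [[a,z],[z̄,b]] > 0` and `g = [[p,w],[w̄,q]] > 0`,
`(det g)·(a + b) ≤ (tr g)·τ(x g)` where `τ(xg) = pa + qb + 2 re(z w̄)`; in particular `τ(x g) ≥ 0`. -/
theorem trace_mul_lower_bound {a b p q : ℝ} {z w : ℂ} (ha : 0 < a) (hz : normSq z < a * b) (hp : 0 < p) (hw : normSq w < p * q) :
    (p * q - normSq w) * (a + b) ≤ (p + q) * (a * p + b * q + 2 * (z * conj w).re) := by
  have hb : 0 < b := snd_pos_of_cone ha hz
  have hρ := re_mul_conj_ge z w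
  set s := ‖z‖ with hs
  set t := ‖w‖ with ht
  have hs0 : 0 ≤ s := norm_nonneg _
  have ht0 : 0 ≤ t := norm_nonneg _
  have hs2 : s ^ 2 < a * b := by rw [hs, Complex.sq_norm]; exact hz
  have ht2 : t ^ 2 = normSq w := by rw [ht, Complex.sq_norm]
  -- `a·(p²a + t²b − 2pst) = (pa − st)² + t²(ab − s²) ≥ 0`, similarly with `b`, `q`
  have h1 : 0 ≤ p ^ 2 * a + t ^ 2 * b - 2 * p * s * t := by
    have key : a * (p ^ 2 * a + t ^ 2 * b - 2 * p * s * t) = (p * a - s * t) ^ 2 + t ^ 2 * (a * b - s ^ 2) := by ring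
    have hnn : 0 ≤ (p * a - s * t) ^ 2 + t ^ 2 * (a * b - s ^ 2) := by
      have : 0 ≤ t ^ 2 * (a * b - s ^ 2) := mul_nonneg (sq_nonneg _) (by linarith)
      positivity
    rw [← key] at hnn
    exact (mul_nonneg_iff_of_pos_left ha).mp hnn
  have h2 : 0 ≤ q ^ 2 * b + t ^ 2 * a - 2 * q * s * t := by
    have key : b * (q ^ 2 * b + t ^ 2 * a - 2 * q * s * t) = (q * b - s * t) ^ 2 + t ^ 2 * (a * b - s ^ 2) := by ring
    have hnn : 0 ≤ (q * b - s * t) ^ 2 + t ^ 2 * (a * b - s ^ 2) := by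
      have : 0 ≤ t ^ 2 * (a * b - s ^ 2) := mul_nonneg (sq_nonneg _) (by linarith)
      positivity
    rw [← key] at hnn
    exact (mul_nonneg_iff_of_pos_left hb).mp hnn
  rw [← ht2]
  nlinarith [h1, h2, hρ, hp, mul_nonneg (add_nonneg hp.le (le_of_lt (snd_pos_of_cone hp hw))) (by linarith [hρ] :
    (0:ℝ) ≤ (z * conj w).re + s * t)]

/-- `τ(x g) ≥ 0` for `x, g > 0` (chart). -/
theorem trace_mul_nonneg {a b p q : ℝ} {z w : ℂ} (ha : 0 < a) (hz : normSq z < a * b) (hp : 0 < p) (hw : normSq w < p * q) :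
    0 ≤ a * p + b * q + 2 * (z * conj w).re := by
  have h := trace_mul_lower_bound ha hz hp hw
  have hb : 0 < b := snd_pos_of_cone ha hz
  have hq : 0 < q := snd_pos_of_cone hp hw
  have hδ : 0 < p * q - normSq w := by linarith
  have hpos : 0 < (p + q) * (a * p + b * q + 2 * (z * conj w).re) := lt_of_lt_of_le (by positivity) h
  exact ((mul_pos_iff_of_pos_left (by linarith : 0 < p + q)).mp hpos).le

/-- DETERMINANT SUPERADDITIVITY (weak form): for `x = [[a,z],[z̄,b]] > 0` and `k = [[p,w],[w̄,q]] > 0`, `det(x + k) ≥ det k`. -/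
theorem det_add_ge {a b p q : ℝ} {z w : ℂ} (ha : 0 < a) (hz : normSq z < a * b) (hp : 0 < p) (hw : normSq w < p * q) :
    p * q - normSq w ≤ (a + p) * (b + q) - normSq (z + w) := by
  have hb : 0 < b := snd_pos_of_cone ha hz
  have hq : 0 < q := snd_pos_of_cone hp hw
  -- `re(z w̄) ≤ ‖z‖‖w‖` (this is ★ `Literature.Topology.FourManifolds.MMSW.re_mul_conj_le`; two lines, not worth the import)
  have hρ : (z * conj w).re ≤ ‖z‖ * ‖w‖ := by
    have h := Complex.abs_re_le_norm (z * conj w)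
    rw [norm_mul, Complex.norm_conj] at h
    linarith [le_abs_self (z * conj w).re]
  set s := ‖z‖ with hs
  set t := ‖w‖ with ht
  have hs0 : 0 ≤ s := norm_nonneg _
  have ht0 : 0 ≤ t := norm_nonneg _
  have hs2 : s ^ 2 < a * b := by rw [hs, Complex.sq_norm]; exact hz
  have ht2 : t ^ 2 < p * q := by rw [ht, Complex.sq_norm]; exact hw
  have hexp : normSq (z + w) = normSq z + normSq w + 2 * (z * conj w).re := Complex.normSq_add z w
  -- `a q + b p ≥ 2 s t`
  have hst : 2 * s * t ≤ a * q + b * p := by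
    have hsq : (2 * s * t) ^ 2 ≤ (a * q + b * p) ^ 2 := by
      have h4 : s ^ 2 * t ^ 2 ≤ (a * b) * (p * q) :=
        mul_le_mul hs2.le ht2.le (sq_nonneg _) (by positivity)
      nlinarith [sq_nonneg (a * q - b * p), h4]
    exact (pow_le_pow_iff_left₀ (by positivity) (by positivity) two_ne_zero).mp hsq
  have hz' : normSq z = s ^ 2 := by rw [hs, Complex.sq_norm]
  rw [hexp, hz']
  nlinarith [hst, hρ, hs2]

/-- `det u ≤ (tr u)²` for `u = [[A, ζ],[ζ̄, B]]` (any real `A, B`). -/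
theorem det_le_trace_sq (A B : ℝ) (ζ : ℂ) : A * B - normSq ζ ≤ (A + B) ^ 2 := by
  nlinarith [normSq_nonneg ζ, sq_nonneg (A - B)]

/-- POLYNOMIAL VERSUS EXPONENTIAL: for `λ > 0`, `T₀ ≥ 0`, `r ≥ 0` there is `K > 0` with `(T/λ + T₀)^r ≤ K · e^{T/2}` for all `T ≥ 0`. -/
theorem rpow_le_const_mul_exp {lam T₀ r : ℝ} (hlam : 0 < lam) (hT₀ : 0 ≤ T₀) (hr : 0 ≤ r) :
    ∃ K : ℝ, 0 < K ∧ ∀ T : ℝ, 0 ≤ T → (T / lam + T₀) ^ r ≤ K * Real.exp (T / 2) := by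
  obtain ⟨n, hn⟩ : ∃ n : ℕ, r ≤ n := exists_nat_ge r
  set c : ℝ := lam / 2 with hc
  have hcpos : 0 < c := by positivity
  refine ⟨(Nat.factorial n : ℝ) * c⁻¹ ^ n * Real.exp (c * (1 + T₀)), by positivity, fun T hT => ?_⟩
  have hy : 0 ≤ T / lam + T₀ := by positivity
  -- `(y)^r ≤ (1 + y)^n`
  have h1 : (T / lam + T₀) ^ r ≤ (1 + (T / lam + T₀)) ^ (n : ℝ) :=
    (Real.rpow_le_rpow hy (by linarith) hr).trans (Real.rpow_le_rpow_of_exponent_le (by linarith) hn)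
  rw [Real.rpow_natCast] at h1
  -- `(1 + y)^n = c^{-n} (c(1 + y))^n ≤ c^{-n} n! e^{c(1+y)}`, and `c(1 + y) = c(1 + T₀) + T/2`
  have h2 : (c * (1 + (T / lam + T₀))) ^ n / (Nat.factorial n : ℝ) ≤ Real.exp (c * (1 + (T / lam + T₀))) :=
    Real.pow_div_factorial_le_exp _ (by positivity) n
  have hfac : (0 : ℝ) < Nat.factorial n := by exact_mod_cast Nat.factorial_pos n
  have h3 : (1 + (T / lam + T₀)) ^ n = c⁻¹ ^ n * (c * (1 + (T / lam + T₀))) ^ n := by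
    rw [mul_pow, ← mul_assoc, ← mul_pow, inv_mul_cancel₀ hcpos.ne', one_pow, one_mul]
  have h4 : c * (1 + (T / lam + T₀)) = c * (1 + T₀) + T / 2 := by
    rw [hc]
    field_simp
    ring
  rw [h4] at h2
  rw [div_le_iff₀ hfac, Real.exp_add] at h2
  calc (T / lam + T₀) ^ r ≤ (1 + (T / lam + T₀)) ^ n := h1
    _ = c⁻¹ ^ n * (c * (1 + (T / lam + T₀))) ^ n := h3
    _ = c⁻¹ ^ n * (c * (1 + T₀) + T / 2) ^ n := by rw [h4]
    _ ≤ c⁻¹ ^ n * (Real.exp (c * (1 + T₀)) * Real.exp (T / 2) * (Nat.factorial n : ℝ)) :=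
        mul_le_mul_of_nonneg_left h2 (by positivity)
    _ = (Nat.factorial n : ℝ) * c⁻¹ ^ n * Real.exp (c * (1 + T₀)) * Real.exp (T / 2) := by ring

/-! ## The key domination on the cone -/

/-- KEY DOMINATION: for `g = [[p,w],[w̄,q]] > 0`, `k = [[p′,w′],[w̄′,q′]] > 0` (think `k = 2h`) and `r : ℝ` (think `r = re α − 2`) there is `K > 0` with
`det(x + k)^r ≤ K · exp(τ(x g)/2)` for every `x = [[a,z],[z̄,b]] > 0`. -/
theorem det_add_rpow_le {p q p' q' : ℝ} {w w' : ℂ} (hp : 0 < p) (hw : normSq w < p * q) (hp' : 0 < p') (hw' : normSq w' < p' * q')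
    (r : ℝ) : ∃ K : ℝ, 0 < K ∧ ∀ (a b : ℝ) (z : ℂ), 0 < a → normSq z < a * b →
      ((a + p') * (b + q') - normSq (z + w')) ^ r ≤ K * Real.exp ((a * p + b * q + 2 * (z * conj w).re) / 2) := by
  have hq : 0 < q := snd_pos_of_cone hp hw
  have hq' : 0 < q' := snd_pos_of_cone hp' hw'
  have hδ : 0 < p * q - normSq w := by linarith
  have hδ' : 0 < p' * q' - normSq w' := by linarith
  rcases le_or_gt r 0 with hr | hr
  · -- `r ≤ 0`: `det(x + k)^r ≤ det(k)^r ≤ det(k)^r · e^{τ/2}`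
    refine ⟨(p' * q' - normSq w') ^ r, Real.rpow_pos_of_pos hδ' r, fun a b z ha hz => ?_⟩
    have hge := det_add_ge ha hz hp' hw'
    have hT := trace_mul_nonneg ha hz hp hw
    calc ((a + p') * (b + q') - normSq (z + w')) ^ r ≤ (p' * q' - normSq w') ^ r := Real.rpow_le_rpow_of_nonpos hδ' hge hr
      _ ≤ (p' * q' - normSq w') ^ r * Real.exp ((a * p + b * q + 2 * (z * conj w).re) / 2) := by
          have : 1 ≤ Real.exp ((a * p + b * q + 2 * (z * conj w).re) / 2) := Real.one_le_exp (by linarith)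
          have h0 : 0 ≤ (p' * q' - normSq w') ^ r := (Real.rpow_pos_of_pos hδ' r).le
          nlinarith
  · -- `r > 0`: `det(x+k) ≤ (tr(x+k))² ≤ (τ(xg)/λ + tr k)²`, `λ = det g / tr g`, then polynomial ≤ K e^{τ/2}
    set lam : ℝ := (p * q - normSq w) / (p + q) with hlam
    have hlampos : 0 < lam := div_pos hδ (by linarith)
    obtain ⟨K, hK, hKle⟩ := rpow_le_const_mul_exp (T₀ := p' + q') (r := 2 * r) hlampos (by linarith) (by linarith)
    refine ⟨K, hK, fun a b z ha hz => ?_⟩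
    have hb : 0 < b := snd_pos_of_cone ha hz
    have hT := trace_mul_nonneg ha hz hp hw
    have hlow := trace_mul_lower_bound ha hz hp hw
    have hdetpos : 0 < (a + p') * (b + q') - normSq (z + w') := lt_of_lt_of_le hδ' (det_add_ge ha hz hp' hw')
    -- `a + b ≤ τ/λ`
    have hab : a + b ≤ (a * p + b * q + 2 * (z * conj w).re) / lam := by
      rw [hlam, div_div_eq_mul_div, le_div_iff₀ hδ]
      linarith
    have htr : (a + p') * (b + q') - normSq (z + w') ≤ ((a * p + b * q + 2 * (z * conj w).re) / lam + (p' + q')) ^ 2 := by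
      calc (a + p') * (b + q') - normSq (z + w') ≤ ((a + p') + (b + q')) ^ 2 := det_le_trace_sq _ _ _
        _ ≤ ((a * p + b * q + 2 * (z * conj w).re) / lam + (p' + q')) ^ 2 := by
            have h0 : 0 ≤ (a + p') + (b + q') := by linarith
            have h1 : (a + p') + (b + q') ≤ (a * p + b * q + 2 * (z * conj w).re) / lam + (p' + q') := by linarith
            exact pow_le_pow_left₀ h0 h1 2
    calc ((a + p') * (b + q') - normSq (z + w')) ^ r
        ≤ (((a * p + b * q + 2 * (z * conj w).re) / lam + (p' + q')) ^ 2) ^ r := Real.rpow_le_rpow hdetpos.le htr hr.le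
      _ = ((a * p + b * q + 2 * (z * conj w).re) / lam + (p' + q')) ^ (2 * r) := by
          rw [show (((a * p + b * q + 2 * (z * conj w).re) / lam + (p' + q')) ^ 2 : ℝ) =
            ((a * p + b * q + 2 * (z * conj w).re) / lam + (p' + q')) ^ (2 : ℝ) by norm_cast, ← Real.rpow_mul (by positivity)]
      _ ≤ K * Real.exp ((a * p + b * q + 2 * (z * conj w).re) / 2) := hKle _ hT

/-! ## Absolute convergence of `η` for `g, h > 0` -/

/-- The translated integrand: `η-integrand(g, h)(x + h) = e^{−τ((x+h)g)} det(x + 2h)^{α−2} det(x)^{β−2}` with `x + h`, `x + 2h` in the chart. -/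
theorem etaTwoIntegrand_add (g : Matrix (Fin 2) (Fin 2) ℂ) (e : ℝ × ℂ × ℝ) (α β : ℂ) (c : ℝ × ℂ × ℝ) :
    etaTwoIntegrand g (hermTwo e) α β (c + e) =
      cexp (-(hermTwo (c + e) * g).trace) * ((hermTwo (c + e + e)).det ^ (α - 2) * (hermTwo c).det ^ (β - 2)) := by
  rw [etaTwoIntegrand_apply, hermTwo_add, hermTwo_add, hermTwo_add, add_sub_cancel_right]

/-- **ABSOLUTE CONVERGENCE OF SHIMURA'S `η` FOR `g, h > 0`** (organ Φ6b-2; [Shimura1982, §3, the `h > 0` half of Thm 3.1, Case II, m = 2]):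
for positive definite `g, h` and `re β > 1`, the integrand of `η(g, h; α, β)` is integrable on its domain `{x ± h > 0} = {x − h > 0}` for
EVERY `α ∈ ℂ` — so `η(g, h; ·, β)` is defined by an absolutely convergent integral on all of `ℂ`. -/
theorem integrableOn_etaTwoIntegrand_of_posDef {g h : Matrix (Fin 2) (Fin 2) ℂ} (hg : g.PosDef) (hh : h.PosDef) (α : ℂ) {β : ℂ}
    (hβ : 1 < β.re) : IntegrableOn (etaTwoIntegrand g h α β) (etaTwoSet h) := by
  -- coordinates of `g` and `h`
  have hg' : hermTwo ((g 0 0).re, g 0 1, (g 1 1).re) = g := hermTwo_eq_of_isHermitian hg.1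
  have hdg := (posDef_hermTwo_iff ((g 0 0).re, g 0 1, (g 1 1).re)).mp (hg'.symm ▸ hg)
  set d : ℝ × ℂ × ℝ := ((g 0 0).re, g 0 1, (g 1 1).re) with hd
  have hh' : hermTwo ((h 0 0).re, h 0 1, (h 1 1).re) = h := hermTwo_eq_of_isHermitian hh.1
  have heh := (posDef_hermTwo_iff ((h 0 0).re, h 0 1, (h 1 1).re)).mp (hh'.symm ▸ hh)
  set e : ℝ × ℂ × ℝ := ((h 0 0).re, h 0 1, (h 1 1).re) with he
  have hp : 0 < d.1 := hdg.1
  have hw : normSq d.2.1 < d.1 * d.2.2 := hdg.2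
  have hq : 0 < d.2.2 := snd_pos_of_cone hp hw
  -- `2h` in the chart
  have h2e : 0 < (e + e).1 ∧ normSq (e + e).2.1 < (e + e).1 * (e + e).2.2 := by
    obtain ⟨h1, h2⟩ := heh
    refine ⟨by simp only [Prod.fst_add]; linarith, ?_⟩
    simp only [Prod.fst_add, Prod.snd_add]
    rw [show e.2.1 + e.2.1 = (2 : ℂ) * e.2.1 by ring, map_mul, show normSq (2 : ℂ) = 4 by norm_num [normSq_apply]]
    nlinarith
  -- the domain is `{x − h > 0}`; translate by `h`
  rw [etaTwoSet_eq_of_posSemidef hh.posSemidef, ← hh']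
  have hT : MeasurePreserving (fun c : ℝ × ℂ × ℝ => c + e) volume volume := by
    have h := (measurePreserving_add_right (volume : Measure ℝ) e.1).prod
      ((measurePreserving_add_right (volume : Measure ℂ) e.2.1).prod (measurePreserving_add_right (volume : Measure ℝ) e.2.2))
    have hf : (fun c : ℝ × ℂ × ℝ => c + e) =
        Prod.map (fun x : ℝ => x + e.1) (Prod.map (fun x : ℂ => x + e.2.1) (fun x : ℝ => x + e.2.2)) := by
      funext c
      rfl
    rw [hf, Measure.volume_eq_prod, Measure.volume_eq_prod]
    exact h
  have hTe : MeasurableEmbedding (fun c : ℝ × ℂ × ℝ => c + e) := (MeasurableEquiv.addRight e).measurableEmbedding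
  have hpre : (fun c : ℝ × ℂ × ℝ => c + e) ⁻¹' {c | (hermTwo c - hermTwo e).PosDef} = {c | (hermTwo c).PosDef} := by
    ext c
    simp only [Set.mem_preimage, Set.mem_setOf_eq, hermTwo_add, add_sub_cancel_right]
  rw [← hT.integrableOn_comp_preimage hTe, hpre]
  -- the key domination constant for `r = re α − 2`
  obtain ⟨K, hK, hKle⟩ := det_add_rpow_le (w := d.2.1) (w' := (e + e).2.1) (q := d.2.2) (q' := (e + e).2.2) hp hw h2e.1 h2e.2 (α.re - 2)
  -- the Siegel–Gindikin majorant at `g/2`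
  have hhalf : 0 < ((1 / 2 : ℝ) • d).1 ∧ normSq ((1 / 2 : ℝ) • d).2.1 < ((1 / 2 : ℝ) • d).1 * ((1 / 2 : ℝ) • d).2.2 := by
    simp only [Prod.smul_fst, Prod.smul_snd, smul_eq_mul, Complex.real_smul]
    refine ⟨by positivity, ?_⟩
    rw [map_mul, show normSq ((1 / 2 : ℝ) : ℂ) = 1 / 4 by rw [normSq_ofReal]; norm_num]
    nlinarith
  have hSG := (integrableOn_siegelGindikin_hermTwo ((1 / 2 : ℝ) • d) hhalf (s := (β.re : ℂ)) (by simpa using hβ)).norm.const_mul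
    (K * Real.exp (-(e.1 * d.1 + e.2.2 * d.2.2 + 2 * (e.2.1 * conj d.2.1).re)))
  refine hSG.mono' ?_ ?_
  · exact ((measurable_etaTwoIntegrand g (hermTwo e) α β).comp (measurable_id.add_const e)).aestronglyMeasurable
  · refine (ae_restrict_iff' measurableSet_posDef_hermTwo).mpr (Filter.Eventually.of_forall fun c hc => ?_)
    have hc' := (posDef_hermTwo_iff c).mp hc
    obtain ⟨a, z, b⟩ := c
    obtain ⟨ha, hz⟩ := hc'
    have hb : 0 < b := snd_pos_of_cone ha hz
    -- names for the real quantities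
    set T : ℝ := a * d.1 + b * d.2.2 + 2 * (z * conj d.2.1).re with hTdef
    set Te : ℝ := e.1 * d.1 + e.2.2 * d.2.2 + 2 * (e.2.1 * conj d.2.1).re with hTedef
    have hdetx : 0 < a * b - normSq z := by linarith
    have h2e' : 0 < e.1 + e.1 ∧ normSq (e.2.1 + e.2.1) < (e.1 + e.1) * (e.2.2 + e.2.2) := by
      simpa only [Prod.fst_add, Prod.snd_add] using h2e
    have hdet2 : 0 < (a + (e.1 + e.1)) * (b + (e.2.2 + e.2.2)) - normSq (z + (e.2.1 + e.2.1)) := by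
      have := det_add_ge (w := e.2.1 + e.2.1) (q := e.2.2 + e.2.2) ha hz h2e'.1 h2e'.2
      linarith [h2e'.2]
    -- the five norms
    have hL1 : ‖cexp (-(hermTwo ((a, z, b) + e) * hermTwo d).trace)‖ = Real.exp (-(T + Te)) := by
      rw [Complex.norm_exp, trace_hermTwo_mul_hermTwo]
      congr 1
      simp only [Prod.fst_add, Prod.snd_add, neg_re, ofReal_re, hTdef, hTedef, add_mul, Complex.add_re, mul_add]
      ring
    have hL2 : ‖(hermTwo ((a, z, b) + e + e)).det ^ (α - 2)‖ =
        ((a + (e.1 + e.1)) * (b + (e.2.2 + e.2.2)) - normSq (z + (e.2.1 + e.2.1))) ^ (α.re - 2) := by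
      have hx : (a, z, b) + e + e = (a + (e.1 + e.1), z + (e.2.1 + e.2.1), b + (e.2.2 + e.2.2)) := by
        ext <;> simp [add_assoc]
      rw [hx, det_hermTwo, norm_cpow_eq_rpow_re_of_pos hdet2]
      simp
    have hL3 : ‖(hermTwo (a, z, b)).det ^ (β - 2)‖ = (a * b - normSq z) ^ (β.re - 2) := by
      rw [det_hermTwo, norm_cpow_eq_rpow_re_of_pos hdetx]
      simp
    have hR1 : ‖cexp (-(hermTwo (a, z, b) * hermTwo ((1 / 2 : ℝ) • d)).trace)‖ = Real.exp (-(T / 2)) := by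
      rw [Complex.norm_exp, trace_hermTwo_mul_hermTwo]
      congr 1
      simp only [Prod.smul_fst, Prod.smul_snd, smul_eq_mul, Complex.real_smul, neg_re, ofReal_re, hTdef, map_mul,
        Complex.conj_ofReal, Complex.mul_re, Complex.mul_im, Complex.ofReal_re, Complex.ofReal_im, zero_mul, sub_zero, add_zero]
      ring
    have hR2 : ‖(hermTwo (a, z, b)).det ^ ((β.re : ℂ) - 2)‖ = (a * b - normSq z) ^ (β.re - 2) := by
      rw [det_hermTwo, norm_cpow_eq_rpow_re_of_pos hdetx]
      simp
    simp only [Function.comp_apply]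
    rw [etaTwoIntegrand_add, ← hg', norm_mul, norm_mul, norm_mul, hL1, hL2, hL3, hR1, hR2]
    -- the domination `det(x+2h)^{re α − 2} · e^{−T/2} ≤ K`
    have hKc := hKle a b z ha hz
    simp only [Prod.fst_add, Prod.snd_add] at hKc
    have hX0 : 0 ≤ Real.exp (-(T / 2)) := (Real.exp_pos _).le
    have hprod : Real.exp (-(T / 2)) * ((a + (e.1 + e.1)) * (b + (e.2.2 + e.2.2)) - normSq (z + (e.2.1 + e.2.1))) ^ (α.re - 2) ≤ K := by
      have h1 := mul_le_mul_of_nonneg_left hKc hX0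
      rw [← mul_assoc, mul_comm (Real.exp _) K, mul_assoc, ← Real.exp_add, show -(T / 2) + T / 2 = 0 by ring,
        Real.exp_zero, mul_one] at h1
      exact h1
    have hP0 : 0 ≤ Real.exp (-Te) * (Real.exp (-(T / 2)) * (a * b - normSq z) ^ (β.re - 2)) := by positivity
    calc Real.exp (-(T + Te)) *
          (((a + (e.1 + e.1)) * (b + (e.2.2 + e.2.2)) - normSq (z + (e.2.1 + e.2.1))) ^ (α.re - 2) * (a * b - normSq z) ^ (β.re - 2))
        = (Real.exp (-Te) * (Real.exp (-(T / 2)) * (a * b - normSq z) ^ (β.re - 2))) *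
            (Real.exp (-(T / 2)) * ((a + (e.1 + e.1)) * (b + (e.2.2 + e.2.2)) - normSq (z + (e.2.1 + e.2.1))) ^ (α.re - 2)) := by
          rw [show -(T + Te) = -Te + -(T / 2) + -(T / 2) by ring, Real.exp_add, Real.exp_add]
          ring
      _ ≤ (Real.exp (-Te) * (Real.exp (-(T / 2)) * (a * b - normSq z) ^ (β.re - 2))) * K :=
          mul_le_mul_of_nonneg_left hprod hP0
      _ = K * Real.exp (-Te) * (Real.exp (-(T / 2)) * (a * b - normSq z) ^ (β.re - 2)) := by ring

/-- `η(g, h; α, β)` for `g, h > 0`, `re β > 1`, is the genuine (absolutely convergent) integral of its integrand over `{x − h > 0}`. -/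
theorem etaTwo_eq_integral_of_posDef {g h : Matrix (Fin 2) (Fin 2) ℂ} (hh : h.PosDef) (α β : ℂ) :
    etaTwo g h α β = ∫ c in {c : ℝ × ℂ × ℝ | (hermTwo c - h).PosDef}, etaTwoIntegrand g h α β c := by
  rw [etaTwo_def, etaTwoSet_eq_of_posSemidef hh.posSemidef]

end Summit.HodgeConjecture.HodgeConjecture.Cruxes.HLiu418.K2LiuHermTwoEtaConvergence

end
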